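/-
Copyright (c) 2026 the pub-hodgecm-mathlib formalisation cell (harness21).  Prover seat hodgecm-mathlib-F0P3a-p04 (g19): road «S3-ram» (LEAD F0P3a-plan (g12); architect
A-p16 (g31); junction pen F0P3a-p01 (g17), J-PACK v2 ROW-ROOT-LBL; owner F0P3a-p06 (g15)); 2026-09-02.
-/
import Literature.NumberTheory.Automorphic.UnitaryLatticeTreeOddVertexChildLabelsRamified    -- ★ p847497 (F0P2-p06): O-LBL `childLabels_of_not_null`; brings ★ J pivot, ★ H tokens, ★ F class
import Literature.NumberTheory.Automorphic.UnitaryLatticeTreeFixedGrandchildFrameRamified     -- ★ p847469 (F0P2-p01): FILE L grandchild frame; brings ★ G3 transport, ★ D `exists_unit_vec_…`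
import HarnessLib

/-!
# The lattice graph of a hermitian space — THE LABELS OF THE ROOT'S GRANDCHILDREN IN THE SEMISIMPLE (EQUILATERAL) REGIME at a tame-ramified place: an isotropic
# residual line is never an eigenline of `Ȳ_root`, so a null line gives an `E`-grandchild and a unit line of class `t` a `P`-grandchild of class `−t`
# (Bruhat–Tits 1972 §10; Tits 1979 §3.5; Kottwitz 1986 §3)

Topic `NumberTheory/Automorphic`; namespace `Literature.NumberTheory.Automorphic.UnitaryLatticeTree`.  THEOREMS ONLY (no definition, no instance, no notation, no named fact,
no `sorry`); kernel lane `--supports stmt-HodgeConjecture-24833`.  Cell `pub/hodgecm-mathlib` (D-0151), crux H413; road «S3-ram» (Literature seeding, count-neutral); the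
(a2) JUNCTION of the type-(1) ramified row (sub-architect F0P3a-p01 (g17), J-PACK v2 `F0/P3a/F0P3a-p01/g17/junction/JPACK-v2.F0P3ap01g17.md`), **ROW-ROOT-LBL «ROOT
GRANDCHILD LABELS, equilateral»** = socket `row_rootLabels` of the junction skeleton v1 (157608bd).

THE SITUATION.  `J₀ = antidiag(1,1,1)` on `K³`, `σ` the conjugation of a tame-RAMIFIED quadratic extension (`σϖ = −ϖ`, residually trivial), root `r₀ = L₀ = 𝒪³`.  The element is
REGULAR SEMISIMPLE AT THE ROOT: `γ = A·diag(s)·A⁻¹` with `A ∈ GL₃(𝒪)` a frame of a diagonal unit form (`diag d = (−det diag d)·ᵗσ(A)J₀A`, `|d_i| = 1`), `s 1 = 1` and the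
EQUILATERAL separation `|s₀ − 1| = |s₂ − 1| = |s₀ − s₂| = |ϖ|^N` (`N ≥ 3`); so `γ − 1` has level `ϖ^N` on `L₀` and the residual leading matrix `Ȳ = red(ϖ^{−N}(γ−1))` is
semisimple with three distinct eigenvalues whose eigenlines `Āē₀, Āē₁, Āē₂` are NON-ISOTROPIC for `J̄₀` (the Gram matrix in the frame is the unit diagonal `d̄`).  A child of the
root is `κ·N₁` (`κ ∈ K₀`), keyed by the isotropic line `x̄ = κ̄ē₀`; a grandchild `w` through it is `latt(κ·g(a,b))` (★ FILE L ∕ ★ D), and in the frame `κ` the element reads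
`M = κ⁻¹(γ−1)κ` of level `ϖ^N` with corner `M₂₀ = B₀(κe₀, (γ−1)κe₀)` (★ `inv_mul_mul_apply_two_zero_eq_B₀`) — the depth-`N` VALUE of the line.

THE NEW BIT (§1): **an isotropic line is never an eigenline of a separated semisimple `Ȳ`** — if BOTH `M₁₀, M₂₀ ≡ 0 (ϖ^{N+1})` then `x̄` is a residual eigenvector of
`κ̄⁻¹Ȳκ̄`, i.e. of `diag(ē)` in the frame `P = A⁻¹κ`: the separation `|e_i − e_j| = |ϖ|^N` leaves at most one coordinate of `Pe₀` a unit, and the isotropy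
`Σ d_i σ(P_{i0})P_{i0} = 0` kills that one too — but `P ∈ GL₃(𝒪)`.  Hence under the null corner `|M₂₀| ≤ |ϖ|^{N+1}` the PIVOT `|M₁₀| = |ϖ|^N` holds (the semisimple twin of
★ J `v_one_zero_eq_of_cube_le_of_corner`, which needs residual NILPOTENCY instead).  §2 the bookkeeping at the root (`κ⁻¹(γ−1)κ = P⁻¹·diag(s−1)·P`, level `ϖ^N`, the corner is
the pairing).  §3 THE ROW: through a NULL line the grandchild is `LEV(ϖ^{N−1}) ∧ ¬LEV(ϖ^N) ∧ ¬LEV₂(ϖ^{2N−1})` (label `E`: ★ H `…_pred_iff` ∕ `not_…_of_pivot` ∕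
`map_sub_one_sq_childLatt_le_scaleLattice_iff_of_corner`); through a UNIT line of class `t` it is `LEV(ϖ^{N−2}) ∧ ¬LEV(ϖ^{N−1}) ∧ LEV₂(ϖ^{2N−3}) ∧ CLS[w](N−2)(−t)` (label
`P^{−t}`: ★ O-LBL `childLabels_of_not_null` + ★ H `exists_mem_childLatt_class_neg_of_lineClass`) — the socket text of J-PACK v2 verbatim.

* §1 `pairing_diagonal_apply`, `v_mul_mul_apply_le_of_le`, **`not_v_col_le_succ_of_conj_diagonal_of_isotropic`**, **`v_one_zero_eq_of_conj_diagonal_of_isotropic_of_corner`**.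
* §2 `coe_inv_mul_sub_one_mul_eq_conj_diagonal`, `pairing_coe_mulVec_single_eq_inv_mul_mul_apply`.
* §3 **`rootGrandchildLabels_equilateral`** (= socket `row_rootLabels`).

HONEST LABEL: HC_CM is proved only modulo the 2 remaining named inputs (hLiu418 24832, h413 24833) until rung 0 closes; nothing printed is asserted here (elementary algebra
over a valuation ring); «S3-ram» has no books consequence.

## References
* [BruhatTits1972] F. Bruhat, J. Tits, *Groupes réductifs sur un corps local I*, Publ. Math. IHÉS 41 (1972), §10 (lattice models; vertex stabilisers and their filtrations).
* [Tits1979] J. Tits, *Reductive groups over local fields*, PSPM 33.1 (1979), §3.5 (congruence filtration; reduction mod `𝔭`).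
* [Kottwitz1986] R. E. Kottwitz, *Base change for unit elements of Hecke algebras*, Compositio Math. 60 (1986), §3 (levels of fixed lattices; shell recursion).
* [Serre1980Trees] J.-P. Serre, *Trees* (1980), Ch. II §1.1–1.2 (lattices, neighbours, levels).
-/

set_option autoImplicit false

noncomputable section

open scoped Valued WithZero Matrix MatrixGroups

namespace Literature.NumberTheory.Automorphic.UnitaryLatticeTree

open Literature.NumberTheory.Automorphic Literature.NumberTheory.Automorphic.HermitianLattice

variable {K : Type*} [Field K] [Valued K ℤᵐ⁰] {σ : K →+* K} {ϖ : K}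

/-! ## §1 An isotropic line is never an eigenline of a separated semisimple `Ȳ` -/

omit [Valued K ℤᵐ⁰] in
/-- The pairing of a diagonal form: `pairing σ (diag c) x y = Σ_i σ(x_i)·c_i·y_i`. [cite: BruhatTits1972, §10] -/
theorem pairing_diagonal_apply {N : ℕ} (σ : K →+* K) (c : Fin N → K) (x y : Fin N → K) :
    pairing σ (Matrix.diagonal c) x y = ∑ i, σ (x i) * c i * y i := by
  rw [pairing_apply]
  refine Finset.sum_congr rfl fun i _ => ?_
  rw [Finset.sum_eq_single i]
  · rw [Matrix.diagonal_apply_eq]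
  · intro j _ hji; rw [Matrix.diagonal_apply_ne _ (Ne.symm hji), mul_zero, zero_mul]
  · intro h; exact absurd (Finset.mem_univ i) h

/-- Entries of `X·D·Y` are `≤ t` when `X, Y` are integral and the entries of `D` are `≤ t`. [cite: Tits1979, §3.5] -/
theorem v_mul_mul_apply_le_of_le {n : ℕ} {X D Y : Matrix (Fin n) (Fin n) K} {t : ℤᵐ⁰} (hX : ∀ i j, Valued.v (X i j) ≤ 1) (hD : ∀ i j, Valued.v (D i j) ≤ t)
    (hY : ∀ i j, Valued.v (Y i j) ≤ 1) (i j : Fin n) : Valued.v ((X * D * Y) i j) ≤ t := by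
  rw [Matrix.mul_apply]
  refine Valuation.map_sum_le _ fun m _ => ?_
  rw [map_mul, Matrix.mul_apply]
  calc Valued.v (∑ l, X i l * D l m) * Valued.v (Y m j) ≤ t * 1 :=
        mul_le_mul' (Valuation.map_sum_le _ fun l _ => by
          rw [map_mul]
          calc Valued.v (X i l) * Valued.v (D l m) ≤ 1 * t := mul_le_mul' (hX i l) (hD l m)
            _ = t := one_mul _) (hY m j)
    _ = t := mul_one _

/-- **AN ISOTROPIC LINE IS NEVER AN EIGENLINE OF A SEPARATED SEMISIMPLE MATRIX** (matrix form).  Let `P ∈ GL₃(𝒪)` (integral with integral inverse), `e : Fin 3 → K` SEPARATED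
at order `N` (`|e_i − e_j| ≥ |ϖ|^N` for `i ≠ j`), and suppose the first column of `P` is ISOTROPIC for a diagonal unit form (`Σ_i σ(P_{i0})·c_i·P_{i0} = 0`, `|c_i| = 1`,
`σ` valuation-preserving).  Then for `M = P⁻¹·diag(e)·P` NOT both `|M₁₀| ≤ |ϖ|^{N+1}` and `|M₂₀| ≤ |ϖ|^{N+1}`: otherwise `(e_i − M₀₀)·P_{i0} ≡ 0 (ϖ^{N+1})` for all `i`,
the separation makes two of the `P_{i0}` divisible by `ϖ`, the isotropy the third, and `1 = (P⁻¹P)₀₀ ≡ 0 (ϖ)`.  Residually: `ē₀` is not an eigenvector of `P̄⁻¹·diag(ē)·P̄`,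
i.e. the isotropic line `P̄ē₀` is none of the (non-isotropic) coordinate eigenlines. [cite: BruhatTits1972, §10] [cite: Tits1979, §3.5] [cite: Kottwitz1986, §3] -/
theorem not_v_col_le_succ_of_conj_diagonal_of_isotropic (hvσ : ∀ z, Valued.v (σ z) = Valued.v z) (hϖ : Valued.v ϖ = WithZero.exp (-1 : ℤ))
    (P : GL (Fin 3) K) (hP : IsIntMatrix (P : Matrix (Fin 3) (Fin 3) K)) (hP' : IsIntMatrix ((P⁻¹ : GL (Fin 3) K) : Matrix (Fin 3) (Fin 3) K))
    (e : Fin 3 → K) {N : ℕ} (hsep : ∀ i j, i ≠ j → Valued.v ϖ ^ N ≤ Valued.v (e i - e j))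
    (c : Fin 3 → K) (hc : ∀ i, Valued.v (c i) = 1)
    (hiso : pairing σ (Matrix.diagonal c) (fun i => (P : Matrix (Fin 3) (Fin 3) K) i 0) (fun i => (P : Matrix (Fin 3) (Fin 3) K) i 0) = 0) :
    ¬ (Valued.v ((((P⁻¹ : GL (Fin 3) K) : Matrix (Fin 3) (Fin 3) K) * Matrix.diagonal e * (P : Matrix (Fin 3) (Fin 3) K)) 1 0) ≤ Valued.v ϖ ^ (N + 1) ∧
        Valued.v ((((P⁻¹ : GL (Fin 3) K) : Matrix (Fin 3) (Fin 3) K) * Matrix.diagonal e * (P : Matrix (Fin 3) (Fin 3) K)) 2 0) ≤ Valued.v ϖ ^ (N + 1)) := by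
  have hϖ0 : ϖ ≠ 0 := fun h0 => by rw [h0, map_zero] at hϖ; exact WithZero.coe_ne_zero hϖ.symm
  have hvϖ0 : Valued.v ϖ ≠ 0 := (Valuation.ne_zero_iff _).2 hϖ0
  have hϖlt : Valued.v ϖ < 1 := by rw [hϖ, ← WithZero.exp_zero]; exact WithZero.exp_lt_exp.2 (by norm_num)
  rintro ⟨h10, h20⟩
  set Pm : Matrix (Fin 3) (Fin 3) K := (P : Matrix (Fin 3) (Fin 3) K) with hPmdef
  set Pi : Matrix (Fin 3) (Fin 3) K := ((P⁻¹ : GL (Fin 3) K) : Matrix (Fin 3) (Fin 3) K) with hPidef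
  set M : Matrix (Fin 3) (Fin 3) K := Pi * Matrix.diagonal e * Pm with hMdef
  have hPPi : Pm * Pi = 1 := by rw [hPmdef, hPidef, ← Units.val_mul, mul_inv_cancel, Units.val_one]
  have hPiP : Pi * Pm = 1 := by rw [hPmdef, hPidef, ← Units.val_mul, inv_mul_cancel, Units.val_one]
  -- `P·M = diag(e)·P`
  have hPM : Pm * M = Matrix.diagonal e * Pm := by
    rw [hMdef, ← Matrix.mul_assoc, ← Matrix.mul_assoc, hPPi, Matrix.one_mul]
  -- row `i`, column `0`: `(e i − M₀₀)·P_{i0} = P_{i1}·M₁₀ + P_{i2}·M₂₀`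
  have hrow : ∀ i, (e i - M 0 0) * Pm i 0 = Pm i 1 * M 1 0 + Pm i 2 * M 2 0 := by
    intro i
    have h := congrFun (congrFun hPM i) 0
    rw [Matrix.mul_apply, Fin.sum_univ_three, Matrix.diagonal_mul] at h
    linear_combination -h
  have hbd : ∀ i, Valued.v (e i - M 0 0) * Valued.v (Pm i 0) ≤ Valued.v ϖ ^ (N + 1) := by
    intro i
    rw [← map_mul, hrow i]
    refine (Valuation.map_add _ _ _).trans (max_le ?_ ?_)
    · rw [map_mul]; exact (mul_le_of_le_one_left zero_le (hP i 1)).trans h10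
    · rw [map_mul]; exact (mul_le_of_le_one_left zero_le (hP i 2)).trans h20
  -- the separation transfers to `M₀₀`: for `i ≠ j` one of `e i − M₀₀`, `e j − M₀₀` is far
  have hfar : ∀ i j, i ≠ j → Valued.v ϖ ^ N ≤ Valued.v (e i - M 0 0) ∨ Valued.v ϖ ^ N ≤ Valued.v (e j - M 0 0) := by
    intro i j hij
    by_contra h
    rw [not_or, not_le, not_le] at h
    have hlt : Valued.v (e i - e j) < Valued.v ϖ ^ N := by
      have e' : e i - e j = (e i - M 0 0) - (e j - M 0 0) := by ring
      rw [e']; exact Valuation.map_sub_lt _ h.1 h.2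
    exact (lt_irrefl _) ((hsep i j hij).trans_lt hlt)
  -- a far index has a frame entry divisible by `ϖ`
  have hsmall : ∀ i, Valued.v ϖ ^ N ≤ Valued.v (e i - M 0 0) → Valued.v (Pm i 0) ≤ Valued.v ϖ := by
    intro i hi
    have hne : Valued.v ϖ ^ N ≠ 0 := pow_ne_zero _ hvϖ0
    have h2 : Valued.v ϖ ^ N * Valued.v (Pm i 0) ≤ Valued.v ϖ ^ N * Valued.v ϖ := by
      rw [← pow_succ]; exact (mul_le_mul' hi le_rfl).trans (hbd i)
    calc Valued.v (Pm i 0) = (Valued.v ϖ ^ N)⁻¹ * (Valued.v ϖ ^ N * Valued.v (Pm i 0)) := by rw [inv_mul_cancel_left₀ hne]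
      _ ≤ (Valued.v ϖ ^ N)⁻¹ * (Valued.v ϖ ^ N * Valued.v ϖ) := mul_le_mul' le_rfl h2
      _ = Valued.v ϖ := inv_mul_cancel_left₀ hne _
  -- the isotropy `Σ σ(P_{i0})·c_i·P_{i0} = 0`, each term of size `|P_{i0}|²`
  have hiso' : σ (Pm 0 0) * c 0 * Pm 0 0 + σ (Pm 1 0) * c 1 * Pm 1 0 + σ (Pm 2 0) * c 2 * Pm 2 0 = 0 := by
    rw [pairing_diagonal_apply, Fin.sum_univ_three] at hiso
    exact hiso
  have hterm : ∀ i, Valued.v (σ (Pm i 0) * c i * Pm i 0) = Valued.v (Pm i 0) * Valued.v (Pm i 0) := by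
    intro i; rw [map_mul, map_mul, hvσ, hc, mul_one]
  have hsq : ∀ {x : K}, Valued.v x * Valued.v x ≤ Valued.v ϖ * Valued.v ϖ → Valued.v x ≤ Valued.v ϖ := fun {x} h => by
    rw [← pow_two, ← pow_two] at h
    exact (pow_le_pow_iff_left₀ zero_le zero_le two_ne_zero).1 h
  -- every frame entry of the column is divisible by `ϖ`: two by the separation, the third by the isotropy
  have hthird : ∀ {i j k : Fin 3}, σ (Pm i 0) * c i * Pm i 0 = -(σ (Pm j 0) * c j * Pm j 0 + σ (Pm k 0) * c k * Pm k 0) →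
      Valued.v (Pm j 0) ≤ Valued.v ϖ → Valued.v (Pm k 0) ≤ Valued.v ϖ → Valued.v (Pm i 0) ≤ Valued.v ϖ := by
    intro i j k hijk hj hk
    apply hsq
    rw [← hterm, hijk, Valuation.map_neg]
    exact (Valuation.map_add _ _ _).trans (max_le (by rw [hterm]; exact mul_le_mul' hj hj) (by rw [hterm]; exact mul_le_mul' hk hk))
  have ht0 : σ (Pm 0 0) * c 0 * Pm 0 0 = -(σ (Pm 1 0) * c 1 * Pm 1 0 + σ (Pm 2 0) * c 2 * Pm 2 0) := by linear_combination hiso'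
  have ht1 : σ (Pm 1 0) * c 1 * Pm 1 0 = -(σ (Pm 0 0) * c 0 * Pm 0 0 + σ (Pm 2 0) * c 2 * Pm 2 0) := by linear_combination hiso'
  have ht2 : σ (Pm 2 0) * c 2 * Pm 2 0 = -(σ (Pm 0 0) * c 0 * Pm 0 0 + σ (Pm 1 0) * c 1 * Pm 1 0) := by linear_combination hiso'
  have h01 := hfar 0 1 (by decide); have h02 := hfar 0 2 (by decide); have h12 := hfar 1 2 (by decide)
  have hP0 : Valued.v (Pm 0 0) ≤ Valued.v ϖ := by
    rcases h01 with h | h1; · exact hsmall 0 h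
    rcases h02 with h | h2'; · exact hsmall 0 h
    exact hthird ht0 (hsmall 1 h1) (hsmall 2 h2')
  have hP1 : Valued.v (Pm 1 0) ≤ Valued.v ϖ := by
    rcases h01 with h0 | h; swap; · exact hsmall 1 h
    rcases h12 with h | h2'; · exact hsmall 1 h
    exact hthird ht1 (hsmall 0 h0) (hsmall 2 h2')
  have hP2 : Valued.v (Pm 2 0) ≤ Valued.v ϖ := by
    rcases h02 with h0 | h; swap; · exact hsmall 2 h
    rcases h12 with h1 | h; swap; · exact hsmall 2 h
    exact hthird ht2 (hsmall 0 h0) (hsmall 1 h1)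
  have hall : ∀ i, Valued.v (Pm i 0) ≤ Valued.v ϖ := by
    intro i; fin_cases i; exacts [hP0, hP1, hP2]
  -- contradiction: `1 = (P⁻¹P)₀₀ = Σ_k (P⁻¹)₀ₖ·P_{k0}` has size `≤ |ϖ| < 1`
  have h1 : (Pi * Pm) 0 0 = 1 := by rw [hPiP, Matrix.one_apply_eq]
  have hlt : Valued.v ((Pi * Pm) 0 0) < 1 := by
    rw [Matrix.mul_apply]
    refine Valuation.map_sum_lt _ one_ne_zero fun k _ => ?_
    rw [map_mul]
    calc Valued.v (Pi 0 k) * Valued.v (Pm k 0) ≤ 1 * Valued.v ϖ := mul_le_mul' (hP' 0 k) (hall k)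
      _ < 1 := by rw [one_mul]; exact hϖlt
  rw [h1, map_one] at hlt
  exact lt_irrefl _ hlt

/-- **THE SEMISIMPLE PIVOT**: with `P, e, c` as above, if `M = P⁻¹·diag(e)·P` has level `ϖ^N` and its corner passes (`|M₂₀| ≤ |ϖ|^{N+1}`: the line is `Q_Ȳ`-null), then
**`|M₁₀| = |ϖ|^N`** (the semisimple twin of ★ J `v_one_zero_eq_of_cube_le_of_corner`). [cite: BruhatTits1972, §10] [cite: Tits1979, §3.5] [cite: Kottwitz1986, §3] -/
theorem v_one_zero_eq_of_conj_diagonal_of_isotropic_of_corner (hvσ : ∀ z, Valued.v (σ z) = Valued.v z) (hϖ : Valued.v ϖ = WithZero.exp (-1 : ℤ))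
    (P : GL (Fin 3) K) (hP : IsIntMatrix (P : Matrix (Fin 3) (Fin 3) K)) (hP' : IsIntMatrix ((P⁻¹ : GL (Fin 3) K) : Matrix (Fin 3) (Fin 3) K))
    (e : Fin 3 → K) {N : ℕ} (hsep : ∀ i j, i ≠ j → Valued.v ϖ ^ N ≤ Valued.v (e i - e j))
    (c : Fin 3 → K) (hc : ∀ i, Valued.v (c i) = 1)
    (hiso : pairing σ (Matrix.diagonal c) (fun i => (P : Matrix (Fin 3) (Fin 3) K) i 0) (fun i => (P : Matrix (Fin 3) (Fin 3) K) i 0) = 0)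
    (h10 : Valued.v ((((P⁻¹ : GL (Fin 3) K) : Matrix (Fin 3) (Fin 3) K) * Matrix.diagonal e * (P : Matrix (Fin 3) (Fin 3) K)) 1 0) ≤ Valued.v ϖ ^ N)
    (h20 : Valued.v ((((P⁻¹ : GL (Fin 3) K) : Matrix (Fin 3) (Fin 3) K) * Matrix.diagonal e * (P : Matrix (Fin 3) (Fin 3) K)) 2 0) ≤ Valued.v ϖ ^ (N + 1)) :
    Valued.v ((((P⁻¹ : GL (Fin 3) K) : Matrix (Fin 3) (Fin 3) K) * Matrix.diagonal e * (P : Matrix (Fin 3) (Fin 3) K)) 1 0) = Valued.v ϖ ^ N := by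
  have hϖ0 : ϖ ≠ 0 := fun h0 => by rw [h0, map_zero] at hϖ; exact WithZero.coe_ne_zero hϖ.symm
  have hvϖ0 : Valued.v ϖ ≠ 0 := (Valuation.ne_zero_iff _).2 hϖ0
  by_contra hne
  -- discreteness: `≤ |ϖ|^N` and `≠ |ϖ|^N` means `≤ |ϖ|^(N+1)`
  have hlt : Valued.v ((((P⁻¹ : GL (Fin 3) K) : Matrix (Fin 3) (Fin 3) K) * Matrix.diagonal e * (P : Matrix (Fin 3) (Fin 3) K)) 1 0) < Valued.v ϖ ^ N :=
    lt_of_le_of_ne h10 hne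
  have hdm : Valued.v ϖ ^ N = Valued.v ϖ ^ (N + 1) * WithZero.exp (1 : ℤ) := by
    rw [pow_succ, hϖ, mul_assoc, ← WithZero.exp_add]; norm_num
  rw [hdm] at hlt
  exact not_v_col_le_succ_of_conj_diagonal_of_isotropic hvσ hϖ P hP hP' e hsep c hc hiso ⟨(WithZero.lt_mul_exp_iff_le (pow_ne_zero _ hvϖ0)).1 hlt, h20⟩

/-! ## §2 The element at the root in the frame of a child -/

omit [Valued K ℤᵐ⁰] in
/-- **`κ⁻¹(γ − 1)κ = (A⁻¹κ)⁻¹·diag(s − 1)·(A⁻¹κ)` for `γ = A·diag(s)·A⁻¹`.** [cite: Tits1979, §3.5] [cite: Serre1980Trees, II.1.1] -/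
theorem coe_inv_mul_sub_one_mul_eq_conj_diagonal (A κ : GL (Fin 3) K) (s : Fin 3 → K) {γm : Matrix (Fin 3) (Fin 3) K}
    (hγA : γm = (A : Matrix (Fin 3) (Fin 3) K) * Matrix.diagonal s * ((A⁻¹ : GL (Fin 3) K) : Matrix (Fin 3) (Fin 3) K)) :
    ((κ⁻¹ : GL (Fin 3) K) : Matrix (Fin 3) (Fin 3) K) * (γm - 1) * (κ : Matrix (Fin 3) (Fin 3) K) =
      (((A⁻¹ * κ)⁻¹ : GL (Fin 3) K) : Matrix (Fin 3) (Fin 3) K) * Matrix.diagonal (fun i => s i - 1) * ((A⁻¹ * κ : GL (Fin 3) K) : Matrix (Fin 3) (Fin 3) K) := by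
  have hAA : (A : Matrix (Fin 3) (Fin 3) K) * ((A⁻¹ : GL (Fin 3) K) : Matrix (Fin 3) (Fin 3) K) = 1 := by rw [← Units.val_mul, mul_inv_cancel, Units.val_one]
  have hdiag : Matrix.diagonal (fun i => s i - 1) = Matrix.diagonal s - 1 := by rw [← Matrix.diagonal_one, Matrix.diagonal_sub]
  rw [hγA, mul_inv_rev, inv_inv, Units.val_mul, Units.val_mul, hdiag]
  simp only [Matrix.mul_sub, Matrix.sub_mul, Matrix.mul_one, Matrix.mul_assoc]
  rw [← Matrix.mul_assoc (A : Matrix (Fin 3) (Fin 3) K) ((A⁻¹ : GL (Fin 3) K) : Matrix (Fin 3) (Fin 3) K), hAA, Matrix.one_mul]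

omit [Valued K ℤᵐ⁰] in
/-- **The corner is the value of the line**: `B₀(κe₀, Y·κe₀) = (κ⁻¹Yκ)₂₀` for unitary `κ` (★ `inv_mul_mul_apply_two_zero_eq_B₀`, in the `pairing ∕ *ᵥ Pi.single` spelling of the
junction sockets). [cite: BruhatTits1972, §10] [cite: Jacobowitz1962, §4] -/
theorem pairing_coe_mulVec_single_eq_inv_mul_mul_apply (κ : unitaryGroupOfForm σ ((StdForm.antidiagonal 3).over K)) (Y : Matrix (Fin 3) (Fin 3) K) :
    pairing σ ((StdForm.antidiagonal 3).over K) (((κ : GL (Fin 3) K) : Matrix (Fin 3) (Fin 3) K) *ᵥ Pi.single 0 1)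
        (Y *ᵥ (((κ : GL (Fin 3) K) : Matrix (Fin 3) (Fin 3) K) *ᵥ Pi.single 0 1)) =
      ((((κ : GL (Fin 3) K)⁻¹ : GL (Fin 3) K) : Matrix (Fin 3) (Fin 3) K) * Y * ((κ : GL (Fin 3) K) : Matrix (Fin 3) (Fin 3) K)) 2 0 := by
  have hx : ((κ : GL (Fin 3) K) : Matrix (Fin 3) (Fin 3) K) *ᵥ (Pi.single 0 1 : Fin 3 → K) = fun i => ((κ : GL (Fin 3) K) : Matrix (Fin 3) (Fin 3) K) i 0 := by
    rw [Matrix.mulVec_single_one]; rfl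
  rw [pairing_antidiagonal, hx, inv_mul_mul_apply_two_zero_eq_B₀]

/-! ## §3 ROW-ROOT-LBL: the labels of the root's grandchildren, equilateral regime -/

/-- **ROW-ROOT-LBL «ROOT GRANDCHILD LABELS, equilateral (semisimple regime at `r₀`)»** — the socket `row_rootLabels` of the junction skeleton (J-PACK v2, F0P3a-p01 (g17)),
binders verbatim.  `γ = A·diag(s)·A⁻¹` with `s 1 = 1`, `|s 0 − 1| = |s 2 − 1| = |s 0 − s 2| = |ϖ|^N` (`N ≥ 3`), `A ∈ GL₃(𝒪)` the frame of
`diag d = (−det diag d) • formCongr σ A J₀` (`|d_i| = 1`); the root child `κ·N₁` (`κ ∈ K₀`) is keyed by the depth-`N` value `t = ϖ^{−N}·B₀(κe₀, (γ−1)κe₀)` of its line, and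
`w ≠ r₀` is a fixed self-dual vertex adjacent to `κ·N₁`.  THEN: if the value is NULL (`|ϖ^{−N}B₀(…)| < 1`) the vertex `w` has `LEV(ϖ^{N−1}) ∧ ¬LEV(ϖ^N) ∧ ¬LEV₂(ϖ^{2N−1})`
(the `E`-label `(N−1, rank 2)`); if it is a UNIT of class `t` the vertex has `LEV(ϖ^{N−2}) ∧ ¬LEV(ϖ^{N−1}) ∧ LEV₂(ϖ^{2N−3}) ∧ CLS[w](N−2)(−t)` (the `P`-label
`(N−2, rank 1, −t)`).  Route: `w = latt(κ·g(a,b))` (★ D moved along `κ`); `M = κ⁻¹(γ−1)κ = P⁻¹diag(s−1)P`, `P = A⁻¹κ ∈ GL₃(𝒪)`, level `ϖ^N`, corner `M₂₀ =` the value;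
NULL ⇒ pivot `|M₁₀| = |ϖ|^N` by §1 (the line `κ̄ē₀` is isotropic, the eigenlines of `Ȳ` are not) ⇒ ★ H; UNIT ⇒ ★ O-LBL `childLabels_of_not_null` + ★ H class token with
`a₀ = 1`.  (the `_`-binders are part of the socket and unused here.) [cite: Kottwitz1986, §3] [cite: BruhatTits1972, §10] [cite: Tits1979, §3.5] -/
theorem rootGrandchildLabels_equilateral (_hσ : ∀ x, σ (σ x) = x) (hvσ : ∀ a, Valued.v (σ a) = Valued.v a) (hσϖ : σ ϖ = -ϖ)
    (hϖ : Valued.v ϖ = WithZero.exp (-1 : ℤ)) (hres : ∀ x : K, Valued.v x ≤ 1 → Valued.v (σ x - x) < 1) (_h2 : Valued.v (2 : K) = 1) [Finite 𝓀[K]]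
    (_hnorm : ∀ u : K, σ u = u → Valued.v (u - 1) < 1 → ∃ z : K, z * σ z = u ∧ Valued.v (z - 1) ≤ Valued.v (u - 1))
    (_hT : (latticeGraph σ ϖ ((StdForm.antidiagonal 3).over K)).IsTree)
    {γ : unitaryGroupOfForm σ ((StdForm.antidiagonal 3).over K)} (_hγ0 : γ ∈ unitaryInt σ ((StdForm.antidiagonal 3).over K))
    (d : Fin 3 → K) (hd : ∀ i, Valued.v (d i) = 1) (_hdσ : ∀ i, σ (d i) = d i)
    (A : GL (Fin 3) K) (hA : IsIntMatrix (A : Matrix (Fin 3) (Fin 3) K)) (hA' : IsIntMatrix ((A⁻¹ : GL (Fin 3) K) : Matrix (Fin 3) (Fin 3) K))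
    (hdA : Matrix.diagonal d = (-(Matrix.diagonal d).det) • formCongr σ A ((StdForm.antidiagonal 3).over K))
    (s : Fin 3 → K) (hs1 : s 1 = 1) (_hsv : ∀ i, Valued.v (s i) = 1) (_hsσ : ∀ i, s i * σ (s i) = 1)
    (hγA : ((γ : GL (Fin 3) K) : Matrix (Fin 3) (Fin 3) K) = (A : Matrix (Fin 3) (Fin 3) K) * Matrix.diagonal s * ((A⁻¹ : GL (Fin 3) K) : Matrix (Fin 3) (Fin 3) K))
    {N : ℕ} (hN3 : 3 ≤ N) (hs0 : Valued.v (s 0 - 1) = Valued.v ϖ ^ N) (hs2 : Valued.v (s 2 - 1) = Valued.v ϖ ^ N) (hs02 : Valued.v (s 0 - s 2) = Valued.v ϖ ^ N)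
    (κ : unitaryGroupOfForm σ ((StdForm.antidiagonal 3).over K)) (hκ : κ ∈ unitaryInt σ ((StdForm.antidiagonal 3).over K))
    {w : {M : Submodule 𝒪[K] (Fin 3 → K) // IsVertex σ ϖ ((StdForm.antidiagonal 3).over K) M}} (_hw : IsSelfDualLattice σ ϖ ((StdForm.antidiagonal 3).over K) w.1) (_hfixw : latticeGraphIso σ ϖ ((StdForm.antidiagonal 3).over K) γ w = w) (hwr : w ≠ ⟨stdLattice K 3, 0, isSelfDualLattice_stdLattice_three_of_v hϖ⟩)
    (hcw : (latticeGraph σ ϖ ((StdForm.antidiagonal 3).over K)).Adj (latticeGraphIso σ ϖ ((StdForm.antidiagonal 3).over K) κ ⟨latt (Matrix.diagonal ![(1 : K), 1, ϖ]), 2, isVertexLattice_two_N₁_of_neg hσϖ hϖ⟩) w) :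
    (Valued.v ((ϖ ^ N)⁻¹ * pairing σ ((StdForm.antidiagonal 3).over K) (((κ : GL (Fin 3) K) : Matrix (Fin 3) (Fin 3) K) *ᵥ Pi.single 0 1) ((((γ : GL (Fin 3) K) : Matrix (Fin 3) (Fin 3) K) - 1) *ᵥ (((κ : GL (Fin 3) K) : Matrix (Fin 3) (Fin 3) K) *ᵥ Pi.single 0 1))) < 1 →
        w.1.map ((Matrix.toLin' (((γ : GL (Fin 3) K) : Matrix (Fin 3) (Fin 3) K) - 1)).restrictScalars 𝒪[K]) ≤ scaleLattice (ϖ ^ (N - 1)) w.1 ∧ ¬ w.1.map ((Matrix.toLin' (((γ : GL (Fin 3) K) : Matrix (Fin 3) (Fin 3) K) - 1)).restrictScalars 𝒪[K]) ≤ scaleLattice (ϖ ^ N) w.1 ∧ ¬ w.1.map ((Matrix.toLin' ((((γ : GL (Fin 3) K) : Matrix (Fin 3) (Fin 3) K) - 1) ^ 2)).restrictScalars 𝒪[K]) ≤ scaleLattice (ϖ ^ (2 * N - 1)) w.1) ∧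
      (∀ t : K, Valued.v t = 1 → Valued.v (((ϖ ^ N)⁻¹ * pairing σ ((StdForm.antidiagonal 3).over K) (((κ : GL (Fin 3) K) : Matrix (Fin 3) (Fin 3) K) *ᵥ Pi.single 0 1) ((((γ : GL (Fin 3) K) : Matrix (Fin 3) (Fin 3) K) - 1) *ᵥ (((κ : GL (Fin 3) K) : Matrix (Fin 3) (Fin 3) K) *ᵥ Pi.single 0 1))) - t) < 1 →
        w.1.map ((Matrix.toLin' (((γ : GL (Fin 3) K) : Matrix (Fin 3) (Fin 3) K) - 1)).restrictScalars 𝒪[K]) ≤ scaleLattice (ϖ ^ (N - 2)) w.1 ∧ ¬ w.1.map ((Matrix.toLin' (((γ : GL (Fin 3) K) : Matrix (Fin 3) (Fin 3) K) - 1)).restrictScalars 𝒪[K]) ≤ scaleLattice (ϖ ^ (N - 1)) w.1 ∧ w.1.map ((Matrix.toLin' ((((γ : GL (Fin 3) K) : Matrix (Fin 3) (Fin 3) K) - 1) ^ 2)).restrictScalars 𝒪[K]) ≤ scaleLattice (ϖ ^ (2 * N - 3)) w.1 ∧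
          (∃ y ∈ w.1, ∃ a : K, Valued.v a = 1 ∧ Valued.v ((ϖ ^ (N - 2))⁻¹ * pairing σ ((StdForm.antidiagonal 3).over K) y ((((γ : GL (Fin 3) K) : Matrix (Fin 3) (Fin 3) K) - 1) *ᵥ y) - (-t) * a ^ 2) < 1)) := by
  have hϖ0 : ϖ ≠ 0 := fun h0 => by rw [h0, map_zero] at hϖ; exact WithZero.coe_ne_zero hϖ.symm
  have hvϖ0 : Valued.v ϖ ≠ 0 := (Valuation.ne_zero_iff _).2 hϖ0
  have hϖlt : Valued.v ϖ < 1 := by rw [hϖ, ← WithZero.exp_zero]; exact WithZero.exp_lt_exp.2 (by norm_num)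
  have hN1 : 1 ≤ N := by omega
  have hN2 : 2 ≤ N := by omega
  -- STEP A — the frame of the grandchild: `w = latt(κ·g(a,b))`, `|a| = 1`, `|b| ≤ 1` (★ D pulled back along `κ`, as in ★ FILE L)
  obtain ⟨a, b, ha, hb, hw1⟩ : ∃ a b : K, Valued.v a = 1 ∧ Valued.v b ≤ 1 ∧
      w.1 = latt (((κ : GL (Fin 3) K) : Matrix (Fin 3) (Fin 3) K) * !![a / ϖ, 0, 0; 0, 1, 0; b, 0, ϖ]) := by
    set w' := latticeGraphIso σ ϖ ((StdForm.antidiagonal 3).over K) κ⁻¹ w with hw'def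
    have hww' : latticeGraphIso σ ϖ ((StdForm.antidiagonal 3).over K) κ w' = w := latticeGraphIso_mul_inv_apply _ _
    have hw' : w' ∈ (latticeGraph σ ϖ ((StdForm.antidiagonal 3).over K)).neighborSet ⟨latt (Matrix.diagonal ![(1 : K), 1, ϖ]), 2, isVertexLattice_two_N₁_of_neg hσϖ hϖ⟩ := by
      rw [SimpleGraph.mem_neighborSet]
      rw [← hww'] at hcw
      exact (latticeGraphIso σ ϖ ((StdForm.antidiagonal 3).over K) κ).map_adj_iff.1 hcw
    have hne' : w'.1 ≠ stdLattice K 3 := by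
      intro h
      apply hwr
      have hroot : w' = ⟨stdLattice K 3, 0, isSelfDualLattice_stdLattice_three_of_v hϖ⟩ := Subtype.ext h
      rw [← hww', hroot, latticeGraphIso_root_eq_of_mem_unitaryInt hϖ hκ]
    obtain ⟨a, b, ha, hb, hw'1⟩ := exists_unit_vec_of_mem_neighborSet_N₁_of_ne_stdLattice hvσ hσϖ hϖ hres hw' hne'
    refine ⟨a, b, ha, hb, ?_⟩
    rw [← hww', latticeGraphIso_apply_val, hw'1, latt_coe_mul_childFrame_eq hϖ _ ha hb]
  -- STEP B — the element in the frame: `M = κ⁻¹(γ−1)κ = P⁻¹·diag(s−1)·P`, `P = A⁻¹κ ∈ GL₃(𝒪)`, of level `ϖ^N`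
  set M : Matrix (Fin 3) (Fin 3) K := (((κ : GL (Fin 3) K)⁻¹ : GL (Fin 3) K) : Matrix (Fin 3) (Fin 3) K) * (((γ : GL (Fin 3) K) : Matrix (Fin 3) (Fin 3) K) - 1) *
      ((κ : GL (Fin 3) K) : Matrix (Fin 3) (Fin 3) K) with hMdef
  set P : GL (Fin 3) K := A⁻¹ * (κ : GL (Fin 3) K) with hPdef
  have hMP : M = ((P⁻¹ : GL (Fin 3) K) : Matrix (Fin 3) (Fin 3) K) * Matrix.diagonal (fun i => s i - 1) * (P : Matrix (Fin 3) (Fin 3) K) := by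
    rw [hMdef, hPdef]; exact coe_inv_mul_sub_one_mul_eq_conj_diagonal A (κ : GL (Fin 3) K) s hγA
  have hκi := (mem_unitaryInt_iff.1 hκ).1
  have hκi' := (mem_unitaryInt_iff.1 hκ).2
  have hP : IsIntMatrix (P : Matrix (Fin 3) (Fin 3) K) := by
    intro i j
    rw [hPdef, Units.val_mul, Matrix.mul_apply]
    exact Valuation.map_sum_le _ fun k _ => by rw [map_mul]; exact mul_le_one' (hA' i k) (hκi k j)
  have hP' : IsIntMatrix ((P⁻¹ : GL (Fin 3) K) : Matrix (Fin 3) (Fin 3) K) := by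
    intro i j
    rw [hPdef, mul_inv_rev, inv_inv, Units.val_mul, Matrix.mul_apply]
    exact Valuation.map_sum_le _ fun k _ => by rw [map_mul]; exact mul_le_one' (hκi' i k) (hA k j)
  have he : ∀ i j, Valued.v (Matrix.diagonal (fun i => s i - 1) i j) ≤ Valued.v ϖ ^ N := by
    intro i j
    by_cases hij : i = j
    · subst hij
      rw [Matrix.diagonal_apply_eq]
      fin_cases i
      · exact hs0.le
      · simp [hs1]
      · exact hs2.le
    · rw [Matrix.diagonal_apply_ne _ hij, map_zero]; exact zero_le
  have hM : ∀ i j, Valued.v (M i j) ≤ Valued.v ϖ ^ N := by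
    intro i j; rw [hMP]; exact v_mul_mul_apply_le_of_le hP' he hP i j
  -- the separation of the eigenvalues of `γ − 1`
  have hsep : ∀ i j : Fin 3, i ≠ j → Valued.v ϖ ^ N ≤ Valued.v ((fun i => s i - 1) i - (fun i => s i - 1) j) := by
    have h01 : Valued.v ((s 0 - 1) - (s 1 - 1)) = Valued.v ϖ ^ N := by rw [hs1, sub_self, sub_zero, hs0]
    have h21 : Valued.v ((s 2 - 1) - (s 1 - 1)) = Valued.v ϖ ^ N := by rw [hs1, sub_self, sub_zero, hs2]
    have h02 : Valued.v ((s 0 - 1) - (s 2 - 1)) = Valued.v ϖ ^ N := by rw [sub_sub_sub_cancel_right, hs02]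
    have hsym : ∀ i j : Fin 3, Valued.v ((s i - 1) - (s j - 1)) = Valued.v ((s j - 1) - (s i - 1)) := fun i j => Valuation.map_sub_swap _ _ _
    have key : ∀ i j : Fin 3, i ≠ j → (i = 0 ∧ j = 1) ∨ (i = 1 ∧ j = 0) ∨ (i = 0 ∧ j = 2) ∨ (i = 2 ∧ j = 0) ∨ (i = 1 ∧ j = 2) ∨ (i = 2 ∧ j = 1) := by decide
    intro i j hij
    rcases key i j hij with ⟨rfl, rfl⟩ | ⟨rfl, rfl⟩ | ⟨rfl, rfl⟩ | ⟨rfl, rfl⟩ | ⟨rfl, rfl⟩ | ⟨rfl, rfl⟩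
    exacts [h01.ge, by rw [hsym]; exact h01.ge, h02.ge, by rw [hsym]; exact h02.ge, by rw [hsym]; exact h21.ge, h21.ge]
  -- the isotropy of the line `κe₀` in the frame `P`: `κe₀ = A·(Pe₀)`, `B₀(κe₀, κe₀) = B₀(e₀, e₀) = 0`, and the Gram matrix in the frame `A` is `(−det diag d)⁻¹·diag d`
  have hdet : (-(Matrix.diagonal d).det) ≠ 0 := by
    rw [neg_ne_zero, Matrix.det_diagonal]
    exact Finset.prod_ne_zero_iff.2 fun i _ h0 => by have := hd i; rw [h0, map_zero] at this; exact zero_ne_one this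
  have hiso : pairing σ (Matrix.diagonal d) (fun i => (P : Matrix (Fin 3) (Fin 3) K) i 0) (fun i => (P : Matrix (Fin 3) (Fin 3) K) i 0) = 0 := by
    have hκu := (mem_unitaryGroupOfForm_antidiagonal_iff (κ : GL (Fin 3) K)).1 κ.2
    have hcol : (fun i => (P : Matrix (Fin 3) (Fin 3) K) i 0) = (P : Matrix (Fin 3) (Fin 3) K) *ᵥ (Pi.single 0 1 : Fin 3 → K) := by
      rw [Matrix.mulVec_single_one]; rfl
    have hAP : (A : Matrix (Fin 3) (Fin 3) K) * (P : Matrix (Fin 3) (Fin 3) K) = ((κ : GL (Fin 3) K) : Matrix (Fin 3) (Fin 3) K) := by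
      rw [hPdef, Units.val_mul, ← Matrix.mul_assoc, ← Units.val_mul, mul_inv_cancel, Units.val_one, Matrix.one_mul]
    have hzero : pairing σ ((StdForm.antidiagonal 3).over K) (((κ : GL (Fin 3) K) : Matrix (Fin 3) (Fin 3) K) *ᵥ (Pi.single 0 1 : Fin 3 → K))
        (((κ : GL (Fin 3) K) : Matrix (Fin 3) (Fin 3) K) *ᵥ (Pi.single 0 1 : Fin 3 → K)) = 0 := by
      rw [pairing_antidiagonal, hκu, B₀_single_left, Pi.single_eq_of_ne (by decide : Fin.rev (0 : Fin 3) ≠ 0)]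
    have hform : formCongr σ A ((StdForm.antidiagonal 3).over K) = (-(Matrix.diagonal d).det)⁻¹ • Matrix.diagonal d := by
      have h := congrArg (fun X : Matrix (Fin 3) (Fin 3) K => (-(Matrix.diagonal d).det)⁻¹ • X) hdA
      simp only [smul_smul, inv_mul_cancel₀ hdet, one_smul] at h
      exact h.symm
    have hsmul : ∀ (cc : K) (H : Matrix (Fin 3) (Fin 3) K) (x y : Fin 3 → K), pairing σ (cc • H) x y = cc * pairing σ H x y := fun cc H x y => by
      simp only [pairing_apply, Matrix.smul_apply, smul_eq_mul, Finset.mul_sum]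
      exact Finset.sum_congr rfl fun i _ => Finset.sum_congr rfl fun j _ => by ring
    rw [← hAP, ← Matrix.mulVec_mulVec, pairing_mulVec_mulVec, hform, hsmul, mul_eq_zero] at hzero
    rcases hzero with h0 | h0
    · exact absurd h0 (inv_ne_zero hdet)
    · rw [hcol]; exact h0
  -- STEP C — the corner is the value of the line
  have hcorner : pairing σ ((StdForm.antidiagonal 3).over K) (((κ : GL (Fin 3) K) : Matrix (Fin 3) (Fin 3) K) *ᵥ Pi.single 0 1)
      ((((γ : GL (Fin 3) K) : Matrix (Fin 3) (Fin 3) K) - 1) *ᵥ (((κ : GL (Fin 3) K) : Matrix (Fin 3) (Fin 3) K) *ᵥ Pi.single 0 1)) = M 2 0 :=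
    pairing_coe_mulVec_single_eq_inv_mul_mul_apply κ _
  -- `|(ϖ^N)⁻¹·x| ⋈ 1` ↔ `|x| ⋈ |ϖ|^N`
  have hpowne : Valued.v ϖ ^ N ≠ 0 := pow_ne_zero _ hvϖ0
  have hscale : ∀ x : K, Valued.v ((ϖ ^ N)⁻¹ * x) = (Valued.v ϖ ^ N)⁻¹ * Valued.v x := fun x => by rw [map_mul, map_inv₀, map_pow]
  refine ⟨fun hnull => ?_, fun t ht hclose => ?_⟩
  · -- NULL line: the corner passes, the pivot holds (§1), label `E = (N−1, rank 2)`
    rw [hcorner, hscale] at hnull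
    have h20lt : Valued.v (M 2 0) < Valued.v ϖ ^ N := by
      have h' := mul_lt_mul_of_pos_left hnull (zero_lt_iff.2 hpowne)
      rwa [← mul_assoc, mul_inv_cancel₀ hpowne, one_mul, mul_one] at h'
    have h20 : Valued.v (M 2 0) ≤ Valued.v ϖ ^ (N + 1) := by
      have hdm : Valued.v ϖ ^ N = Valued.v ϖ ^ (N + 1) * WithZero.exp (1 : ℤ) := by
        rw [pow_succ, hϖ, mul_assoc, ← WithZero.exp_add]; norm_num
      rw [hdm] at h20lt
      exact (WithZero.lt_mul_exp_iff_le (pow_ne_zero _ hvϖ0)).1 h20lt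
    have h10 : Valued.v (M 1 0) = Valued.v ϖ ^ N := by
      have h := v_one_zero_eq_of_conj_diagonal_of_isotropic_of_corner hvσ hϖ P hP hP' (fun i => s i - 1) hsep d hd hiso
        (by rw [← hMP]; exact hM 1 0) (by rw [← hMP]; exact h20)
      rwa [← hMP] at h
    rw [hw1]
    exact ⟨(map_sub_one_childLatt_le_scaleLattice_pred_iff hϖ (κ : GL (Fin 3) K) (γ : GL (Fin 3) K) ha hb hN1 hM).2 h20,
      not_map_sub_one_childLatt_le_scaleLattice_of_pivot hϖ (κ : GL (Fin 3) K) (γ : GL (Fin 3) K) ha hb hN1 hM h10,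
      fun h => ((map_sub_one_sq_childLatt_le_scaleLattice_iff_of_corner hvσ hϖ κ γ ha hb hN1 hM h20).1 h) h10⟩
  · -- UNIT line of class `t`: the corner is a unit at order `N`, label `P = (N−2, rank ≤ 1, class −t)`
    have h20 : ¬ Valued.v (M 2 0) ≤ Valued.v ϖ ^ (N + 1) := by
      intro hle
      -- `|(ϖ^N)⁻¹M₂₀| ≤ |ϖ| < 1 = |t|`, so `|(ϖ^N)⁻¹M₂₀ − t| = 1`
      have hsmall : Valued.v ((ϖ ^ N)⁻¹ * M 2 0) < 1 := by
        rw [hscale]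
        calc (Valued.v ϖ ^ N)⁻¹ * Valued.v (M 2 0) ≤ (Valued.v ϖ ^ N)⁻¹ * Valued.v ϖ ^ (N + 1) := mul_le_mul' le_rfl hle
          _ = Valued.v ϖ := by rw [pow_succ, ← mul_assoc, inv_mul_cancel₀ hpowne, one_mul]
          _ < 1 := hϖlt
      rw [hcorner] at hclose
      have hsub : Valued.v ((ϖ ^ N)⁻¹ * M 2 0 - t) = Valued.v t := by
        rw [← ht] at hsmall
        exact Valuation.map_sub_eq_of_lt_right _ hsmall
      rw [hsub, ht] at hclose
      exact lt_irrefl _ hclose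
    obtain ⟨hl1, hl2, hl3⟩ := childLabels_of_not_null hϖ κ γ ha hb hN2 hM h20
    rw [hw1]
    refine ⟨hl1, hl2, hl3, ?_⟩
    refine exists_mem_childLatt_class_neg_of_lineClass hvσ hσϖ hϖ hres κ γ ha hb hN2 hM ⟨1, by rw [map_one], ?_⟩
    rw [one_pow, mul_one]
    rw [hcorner] at hclose
    exact hclose

end Literature.NumberTheory.Automorphic.UnitaryLatticeTree

end
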